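import Summits.BirchSwinnertonDyer.BirchSwinnertonDyer.Theorems.ResidualThetaTransportAtTwoThetaLayerLambdaCongruenceAtTwoDepletion
import HarnessLib

/-!
# Crux `ThetaLayerLambdaCongruenceAtTwo` (stmt-BirchSwinnertonDyer-20688, route ResidualThetaTransportAtTwo), line
# `birth`: HECKE ALGEBRA OF DILATION OPERATORS on `1`-periodic functions — the depleted plus symbols are eigen for the
# FULL Hecke algebra (generic part) (width prover bsd-wall-rtt-p3-w2 g0; `--supports stmt-BirchSwinnertonDyer-20688
# --as helper`; closes nothing)

HONEST FRAMING. Pure algebra of finite sums; nothing about any curve or form is asserted; BSD is not proved by any of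
this.

WHAT. For a `1`-periodic `ψ : ℚ → K` write `[m]ψ(x) = ψ(m x)` (dilation by `m ∈ ℕ`), `U_q ψ(r) = ∑_{j<q} ψ((r+j)/q)`
and `T_q = U_q + [q]`; an element `D = ∑ a_m [m]` of the monoid algebra `K[ℕ^×]` (`MonoidAlgebra K ℕ`) acts by
`(D·ψ)(x) = ∑ a_m ψ(m x)` (written `D.coeff.sum (fun m a ↦ a * ψ (m x))`, no new definition). PROVED:
* §1 `U_q [m] = [m] U_q` for `m` coprime to `q` (`sum_fin_apply_mul_div`: `j ↦ m j mod q` permutes the residues;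
  periodicity), `U_q [q] = q`, `U_q [q²] = q [q]` (`sum_fin_apply_mul_self_div`, `…_sq_div`);
* §2 the action is additive and MULTIPLICATIVE in `D` (`act_single`, `act_add`, `act_sum`, `act_mul`);
* §3 a HECKE RELATION `a·ψ = U_q ψ + e·[q]ψ` (`e ∈ K`; `e = 1` for `T_q ψ = a ψ`, `e = 0` for `U_q ψ = a ψ`) is
  preserved by the action of any `D` supported on integers coprime to `q` (`heckeRel_act_of_coprime`), and is KILLED
  by the depletion factor at `q`: `U_q (ψ − a q⁻¹ [q]ψ + e q⁻¹ [q²]ψ) = 0` (`heckeU_act_depletionFactor_eq_zero`) —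
  the symbol-level form of «`f | (1 − a_q V_q + e q V_q²)` is killed by `U_q`».
The companion `…DepletedHecke.lean` applies this to the depletion operator `∏_{v∈S₀} P_v(ℓ_v⁻¹[ℓ_v])` of the crux and
to the plus symbols of `g` and `W` (tree Hecke relations `cuspCoeff_mul_plusSymbol`, `…_of_dvd`).

References: [GreenbergVatsal2000] §1 (8); [Cremona1997] §2.4–2.8 (Hecke action on modular symbols); [MazurTateTeitelbaum1986Invent] §I.4.
-/

noncomputable section

-- justification: the `Summit.BirchSwinnertonDyer.BirchSwinnertonDyer.…` path repeats a component (route-file convention)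
set_option linter.dupNamespace false

open scoped Classical

namespace Summit.BirchSwinnertonDyer.BirchSwinnertonDyer.Theorems.ThetaLayerLambdaCongruenceAtTwo

/-! ## §1. `U_q` against dilations -/

section Dilations

variable {K : Type*} [CommRing K]

/-- **`U_q [m] = [m] U_q` for `m` coprime to `q`**: for a `1`-periodic `ψ`,
`∑_{j<q} ψ(m (r+j)/q) = ∑_{j<q} ψ((m r + j)/q)` (`j ↦ m j mod q` permutes `{0,…,q−1}`). [cite: CremonaAlgorithms1997, §2.4] -/
theorem sum_fin_apply_mul_div (ψ : ℚ → K) (hper : ∀ (x : ℚ) (k : ℤ), ψ (x + k) = ψ x) {q : ℕ} (hq : 0 < q)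
    {m : ℕ} (hm : m.Coprime q) (r : ℚ) :
    ∑ j : Fin q, ψ ((m : ℚ) * ((r + j) / q)) = ∑ j : Fin q, ψ (((m : ℚ) * r + j) / q) := by
  -- the permutation `j ↦ m j mod q`
  have hinj : Function.Injective (fun j : Fin q ↦ (⟨m * j % q, Nat.mod_lt _ hq⟩ : Fin q)) := by
    intro j₁ j₂ h
    have h' : m * j₁ % q = m * j₂ % q := by simpa using congrArg Fin.val h
    have hmod : (j₁ : ℕ) ≡ j₂ [MOD q] :=
      Nat.ModEq.cancel_left_of_coprime (by simpa [Nat.coprime_comm] using hm) h'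
    exact Fin.ext (Nat.ModEq.eq_of_lt_of_lt hmod j₁.2 j₂.2)
  have hbij := (Finite.injective_iff_bijective.mp hinj)
  have hq0 : (q : ℚ) ≠ 0 := by exact_mod_cast hq.ne'
  conv_rhs => rw [← Equiv.sum_comp (Equiv.ofBijective _ hbij)]
  refine Finset.sum_congr rfl fun j _ ↦ ?_
  simp only [Equiv.ofBijective_apply]
  have hdiv : (m * (j : ℕ) : ℕ) = q * (m * j / q) + m * j % q := (Nat.div_add_mod _ _).symm
  have h1 : ((m : ℚ) * (j : ℚ)) = (q : ℚ) * ((m * j / q : ℕ) : ℚ) + ((m * j % q : ℕ) : ℚ) := by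
    exact_mod_cast hdiv
  have e : (m : ℚ) * ((r + j) / q) = ((m : ℚ) * r + ((m * j % q : ℕ) : ℚ)) / q + (((m * j / q : ℕ) : ℤ) : ℚ) := by
    rw [Int.cast_natCast]
    field_simp
    linear_combination h1
  rw [e, hper]

/-- `∑_{j<q} ψ(r + j) = q • ψ(r)` for a `1`-periodic `ψ` (`U_q [q] = q`). [folklore] -/
theorem sum_fin_apply_add_natCast (ψ : ℚ → K) (hper : ∀ (x : ℚ) (k : ℤ), ψ (x + k) = ψ x) (q : ℕ) (r : ℚ) :
    ∑ j : Fin q, ψ (r + j) = (q : K) * ψ r := by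
  have h : ∀ j : Fin q, ψ (r + j) = ψ r := fun j ↦ by exact_mod_cast hper r (j : ℕ)
  simp only [h, Finset.sum_const, Finset.card_univ, Fintype.card_fin, nsmul_eq_mul]

/-- `U_q [q] ψ = q·ψ`: `∑_{j<q} ψ(q (r+j)/q) = q ψ(r)`. [folklore] -/
theorem sum_fin_apply_mul_self_div (ψ : ℚ → K) (hper : ∀ (x : ℚ) (k : ℤ), ψ (x + k) = ψ x) {q : ℕ} (hq : 0 < q)
    (r : ℚ) : ∑ j : Fin q, ψ ((q : ℚ) * ((r + j) / q)) = (q : K) * ψ r := by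
  have hq0 : (q : ℚ) ≠ 0 := by exact_mod_cast hq.ne'
  have e : ∀ j : Fin q, (q : ℚ) * ((r + j) / q) = r + j := fun j ↦ by field_simp
  rw [Finset.sum_congr rfl fun j _ ↦ by rw [e j]]
  exact sum_fin_apply_add_natCast ψ hper q r

/-- `U_q [q²] ψ = q·[q]ψ`: `∑_{j<q} ψ(q² (r+j)/q) = q ψ(q r)`. [folklore] -/
theorem sum_fin_apply_sq_mul_div (ψ : ℚ → K) (hper : ∀ (x : ℚ) (k : ℤ), ψ (x + k) = ψ x) {q : ℕ} (hq : 0 < q)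
    (r : ℚ) : ∑ j : Fin q, ψ (((q ^ 2 : ℕ) : ℚ) * ((r + j) / q)) = (q : K) * ψ ((q : ℚ) * r) := by
  have hq0 : (q : ℚ) ≠ 0 := by exact_mod_cast hq.ne'
  have e : ∀ j : Fin q, ((q ^ 2 : ℕ) : ℚ) * ((r + j) / q) = (q : ℚ) * r + ((q * j : ℕ) : ℤ) := fun j ↦ by
    push_cast; field_simp
  have h : ∀ j : Fin q, ψ (((q ^ 2 : ℕ) : ℚ) * ((r + j) / q)) = ψ ((q : ℚ) * r) := fun j ↦ by rw [e, hper]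
  simp only [h, Finset.sum_const, Finset.card_univ, Fintype.card_fin, nsmul_eq_mul]

end Dilations

/-! ## §2. The action of `K[ℕ^×]` on functions: additive and multiplicative -/

section Action

variable {K : Type*} [CommRing K]

/-- `(single m a)·ψ (x) = a ψ(m x)`. [folklore] -/
theorem act_single (ψ : ℚ → K) (m : ℕ) (a : K) (x : ℚ) :
    ((MonoidAlgebra.single m a : MonoidAlgebra K ℕ).coeff.sum fun m' a' ↦ a' * ψ ((m' : ℚ) * x)) =
      a * ψ ((m : ℚ) * x) := by
  rw [MonoidAlgebra.coeff_single, Finsupp.sum_single_index]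
  rw [zero_mul]

/-- Additivity of the action in `D`. [folklore] -/
theorem act_add (ψ : ℚ → K) (D₁ D₂ : MonoidAlgebra K ℕ) (x : ℚ) :
    ((D₁ + D₂).coeff.sum fun m a ↦ a * ψ ((m : ℚ) * x)) =
      (D₁.coeff.sum fun m a ↦ a * ψ ((m : ℚ) * x)) + D₂.coeff.sum fun m a ↦ a * ψ ((m : ℚ) * x) := by
  rw [MonoidAlgebra.coeff_add, Finsupp.sum_add_index']
  · intro m; rw [zero_mul]
  · intro m a b; rw [add_mul]

/-- The action of a finite sum of operators. [folklore] -/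
theorem act_sum (ψ : ℚ → K) {α : Type*} (s : Finset α) (D : α → MonoidAlgebra K ℕ) (x : ℚ) :
    ((∑ i ∈ s, D i).coeff.sum fun m a ↦ a * ψ ((m : ℚ) * x)) =
      ∑ i ∈ s, (D i).coeff.sum fun m a ↦ a * ψ ((m : ℚ) * x) := by
  classical
  induction s using Finset.induction_on with
  | empty => simp
  | insert i s hi ih => rw [Finset.sum_insert hi, Finset.sum_insert hi, act_add, ih]

/-- **Multiplicativity**: `(D₁ D₂)·ψ = D₁·(D₂·ψ)` (`[m₁][m₂] = [m₁ m₂]`). [folklore] -/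
theorem act_mul (ψ : ℚ → K) (D₁ D₂ : MonoidAlgebra K ℕ) (x : ℚ) :
    ((D₁ * D₂).coeff.sum fun m a ↦ a * ψ ((m : ℚ) * x)) =
      D₁.coeff.sum fun m₁ a₁ ↦ a₁ * (D₂.coeff.sum fun m₂ a₂ ↦ a₂ * ψ ((m₂ : ℚ) * ((m₁ : ℚ) * x))) := by
  rw [MonoidAlgebra.mul_def, MonoidAlgebra.coeff_finsuppSum, Finsupp.sum_sum_index]
  · refine Finsupp.sum_congr fun m₁ _ ↦ ?_
    rw [MonoidAlgebra.coeff_finsuppSum, Finsupp.sum_sum_index, Finsupp.mul_sum]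
    · refine Finsupp.sum_congr fun m₂ _ ↦ ?_
      rw [MonoidAlgebra.coeff_single, Finsupp.sum_single_index]
      · push_cast; ring_nf
      · rw [zero_mul]
    · intro m; rw [zero_mul]
    · intro m a b; rw [add_mul]
  · intro m; rw [zero_mul]
  · intro m a b; rw [add_mul]

end Action

/-! ## §3. Hecke relations: preserved by coprime operators, killed by the depletion factor -/

section Hecke

variable {K : Type*} [Field K]

/-- The action preserves `1`-periodicity. [folklore] -/
theorem act_periodic (ψ : ℚ → K) (hper : ∀ (x : ℚ) (k : ℤ), ψ (x + k) = ψ x) (D : MonoidAlgebra K ℕ) (x : ℚ)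
    (k : ℤ) : (D.coeff.sum fun m a ↦ a * ψ ((m : ℚ) * (x + k))) = D.coeff.sum fun m a ↦ a * ψ ((m : ℚ) * x) := by
  refine Finsupp.sum_congr fun m _ ↦ ?_
  rw [mul_add, show (m : ℚ) * (k : ℚ) = ((m * k : ℤ) : ℚ) by push_cast; ring, hper]

/-- **A `q`-Hecke relation is preserved by operators supported on integers coprime to `q`.** If
`a·ψ(r) = ∑_{j<q} ψ((r+j)/q) + c q⁻¹·ψ(q r)` for all `r` (`T_q`-relation for `c = q`, `U_q`-relation for `c = 0`) and
every `m` in the support of `D` is coprime to `q`, then `D·ψ` satisfies the same relation. [cite: CremonaAlgorithms1997, §2.4] -/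
theorem heckeRel_act_of_coprime (ψ : ℚ → K) (hper : ∀ (x : ℚ) (k : ℤ), ψ (x + k) = ψ x) {q : ℕ} (hq : 0 < q)
    {a c : K} (hrel : ∀ r : ℚ, a * ψ r = (∑ j : Fin q, ψ ((r + j) / q)) + c * (q : K)⁻¹ * ψ ((q : ℚ) * r))
    (D : MonoidAlgebra K ℕ) (hD : ∀ m ∈ D.coeff.support, m.Coprime q) (r : ℚ) :
    a * (D.coeff.sum fun m b ↦ b * ψ ((m : ℚ) * r)) =
      (∑ j : Fin q, D.coeff.sum fun m b ↦ b * ψ ((m : ℚ) * ((r + j) / q))) +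
        c * (q : K)⁻¹ * D.coeff.sum fun m b ↦ b * ψ ((m : ℚ) * ((q : ℚ) * r)) := by
  simp only [Finsupp.sum, Finset.mul_sum]
  rw [Finset.sum_comm, ← Finset.sum_add_distrib]
  refine Finset.sum_congr rfl fun m hm ↦ ?_
  rw [← Finset.mul_sum, sum_fin_apply_mul_div ψ hper hq (hD m hm) r,
    show (m : ℚ) * ((q : ℚ) * r) = (q : ℚ) * ((m : ℚ) * r) by ring]
  conv_lhs => rw [mul_left_comm, hrel ((m : ℚ) * r)]
  ring

/-- **The depletion factor at `q` is killed by `U_q`.** If `a·ψ(r) = ∑_{j<q} ψ((r+j)/q) + c q⁻¹·ψ(q r)` for all `r`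
(`ψ` `1`-periodic, `q ≠ 0` in `K`), then for `D_q = [1] − a q⁻¹ [q] + c q⁻² [q²]` — the operator
`P(q⁻¹[q])` for `P = 1 − a X + c X²` — one has `U_q (D_q·ψ) = 0`: `U_q ψ = aψ − c q⁻¹[q]ψ`, `U_q[q]ψ = qψ`,
`U_q[q²]ψ = q[q]ψ`. This is the symbol-level form of «`f | (1 − a_q q⁻¹ V_q + c q⁻² V_q²)` is killed by `U_q`».
[cite: GreenbergVatsal2000, §1 p. 9 (display (8))] -/
theorem heckeU_act_depletionFactor_eq_zero (ψ : ℚ → K) (hper : ∀ (x : ℚ) (k : ℤ), ψ (x + k) = ψ x) {q : ℕ}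
    (hq : 0 < q) (hqK : (q : K) ≠ 0) {a c : K}
    (hrel : ∀ r : ℚ, a * ψ r = (∑ j : Fin q, ψ ((r + j) / q)) + c * (q : K)⁻¹ * ψ ((q : ℚ) * r)) (r : ℚ) :
    ∑ j : Fin q, ((MonoidAlgebra.single 1 1 + MonoidAlgebra.single q (-(a * (q : K)⁻¹)) +
        MonoidAlgebra.single (q ^ 2) (c * ((q : K)⁻¹) ^ 2) : MonoidAlgebra K ℕ).coeff.sum
          fun m b ↦ b * ψ ((m : ℚ) * ((r + j) / q))) = 0 := by
  simp only [act_add, act_single, Finset.sum_add_distrib, ← Finset.mul_sum, Nat.cast_one, one_mul]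
  have hU : ∑ j : Fin q, ψ ((r + j) / q) = a * ψ r - c * (q : K)⁻¹ * ψ ((q : ℚ) * r) := by
    rw [hrel r]; ring
  rw [hU, sum_fin_apply_mul_self_div ψ hper hq, sum_fin_apply_sq_mul_div ψ hper hq]
  field_simp
  ring

/-- The support of a depletion factor `∑_{k<3} single (q^k) (c_k)` consists of powers of `q`. [folklore] -/
theorem mem_support_depletionFactor {q : ℕ} {c : ℕ → K} {m : ℕ}
    (hm : m ∈ ((∑ k ∈ Finset.range 3, MonoidAlgebra.single (q ^ k) (c k) : MonoidAlgebra K ℕ)).coeff.support) :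
    ∃ k, m = q ^ k := by
  rw [MonoidAlgebra.coeff_sum] at hm
  obtain ⟨k, -, hk⟩ := Finset.mem_biUnion.mp (Finsupp.support_finsetSum hm)
  rw [MonoidAlgebra.coeff_single] at hk
  exact ⟨k, (Finsupp.mem_support_single _ _ _).mp hk |>.1⟩

/-- **Operators built from primes other than `q` preserve a `q`-Hecke relation**: if `ψ` is `1`-periodic with
`a·ψ = U_q ψ + c q⁻¹ [q]ψ` and every `ℓ_v`, `v ∈ S`, is coprime to `q`, then `(∏_{v∈S} D_v)·ψ` satisfies the same
relation, for depletion factors `D_v = ∑_{k<3} single (ℓ_v^k) (c_{v,k})`. [cite: CremonaAlgorithms1997, §2.4] -/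
theorem heckeRel_act_prod_depletionFactor (ψ : ℚ → K) (hper : ∀ (x : ℚ) (k : ℤ), ψ (x + k) = ψ x) {q : ℕ}
    (hq : 0 < q) {a c : K}
    (hrel : ∀ r : ℚ, a * ψ r = (∑ j : Fin q, ψ ((r + j) / q)) + c * (q : K)⁻¹ * ψ ((q : ℚ) * r))
    {α : Type*} (S : Finset α) (ℓ : α → ℕ) (hℓ : ∀ v ∈ S, (ℓ v).Coprime q) (cf : α → ℕ → K) :
    (∀ (x : ℚ) (k : ℤ), ((∏ v ∈ S, ∑ k ∈ Finset.range 3, MonoidAlgebra.single (ℓ v ^ k) (cf v k) :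
        MonoidAlgebra K ℕ).coeff.sum fun m b ↦ b * ψ ((m : ℚ) * (x + k))) =
      (∏ v ∈ S, ∑ k ∈ Finset.range 3, MonoidAlgebra.single (ℓ v ^ k) (cf v k) :
        MonoidAlgebra K ℕ).coeff.sum fun m b ↦ b * ψ ((m : ℚ) * x)) ∧
    ∀ r : ℚ, a * ((∏ v ∈ S, ∑ k ∈ Finset.range 3, MonoidAlgebra.single (ℓ v ^ k) (cf v k) :
        MonoidAlgebra K ℕ).coeff.sum fun m b ↦ b * ψ ((m : ℚ) * r)) =
      (∑ j : Fin q, (∏ v ∈ S, ∑ k ∈ Finset.range 3, MonoidAlgebra.single (ℓ v ^ k) (cf v k) :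
        MonoidAlgebra K ℕ).coeff.sum fun m b ↦ b * ψ ((m : ℚ) * ((r + j) / q))) +
        c * (q : K)⁻¹ * (∏ v ∈ S, ∑ k ∈ Finset.range 3, MonoidAlgebra.single (ℓ v ^ k) (cf v k) :
          MonoidAlgebra K ℕ).coeff.sum fun m b ↦ b * ψ ((m : ℚ) * ((q : ℚ) * r)) := by
  refine ⟨fun x k ↦ act_periodic ψ hper _ x k, ?_⟩
  classical
  induction S using Finset.induction_on with
  | empty =>
    intro r
    simp only [Finset.prod_empty, MonoidAlgebra.one_def, act_single, Nat.cast_one, one_mul]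
    exact hrel r
  | insert v S hv ih =>
    intro r
    have ih' := ih (fun w hw ↦ hℓ w (Finset.mem_insert_of_mem hw))
    rw [Finset.prod_insert hv]
    simp only [act_mul]
    -- the inner function `y ↦ (∏_{S} D)·ψ (y)` is periodic and satisfies the relation (`ih'`); apply the single factor
    have hperS : ∀ (x : ℚ) (k : ℤ), ((∏ w ∈ S, ∑ k ∈ Finset.range 3, MonoidAlgebra.single (ℓ w ^ k) (cf w k) :
        MonoidAlgebra K ℕ).coeff.sum fun m b ↦ b * ψ ((m : ℚ) * (x + k))) =
      (∏ w ∈ S, ∑ k ∈ Finset.range 3, MonoidAlgebra.single (ℓ w ^ k) (cf w k) :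
        MonoidAlgebra K ℕ).coeff.sum fun m b ↦ b * ψ ((m : ℚ) * x) := fun x k ↦ act_periodic ψ hper _ x k
    have hD : ∀ m ∈ ((∑ k ∈ Finset.range 3, MonoidAlgebra.single (ℓ v ^ k) (cf v k) :
        MonoidAlgebra K ℕ)).coeff.support, m.Coprime q := by
      intro m hm
      obtain ⟨k, rfl⟩ := mem_support_depletionFactor hm
      exact Nat.Coprime.pow_left _ (hℓ v (Finset.mem_insert_self v S))
    exact heckeRel_act_of_coprime _ hperS hq ih' _ hD r

/-- **The depletion operator is killed by `U_{ℓ_{v₀}}` for `v₀ ∈ S`.** Let `ψ` be `1`-periodic, `S` a finite set with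
pairwise distinct moduli `ℓ_v` that are pairwise coprime, and suppose at `q = ℓ_{v₀}` (`v₀ ∈ S`, `q ≠ 0` in `K`) the
Hecke relation `a·ψ = U_q ψ + c q⁻¹ [q]ψ` holds, the depletion factor at `v₀` being
`D_{v₀} = [1] − a q⁻¹[q] + c q⁻²[q²]` (`cf v₀ 0 = 1`, `cf v₀ 1 = −a q⁻¹`, `cf v₀ 2 = c q⁻²`). Then
`U_q ((∏_{v∈S} D_v)·ψ) = 0`. [cite: GreenbergVatsal2000, §1 p. 9 (display (8))] -/
theorem heckeU_act_prod_depletionFactor_eq_zero (ψ : ℚ → K) (hper : ∀ (x : ℚ) (k : ℤ), ψ (x + k) = ψ x)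
    {α : Type*} (S : Finset α) (ℓ : α → ℕ) (cf : α → ℕ → K) {v₀ : α} (hv₀ : v₀ ∈ S)
    (hq : 0 < ℓ v₀) (hqK : (ℓ v₀ : K) ≠ 0) (hcop : ∀ v ∈ S, v ≠ v₀ → (ℓ v).Coprime (ℓ v₀)) {a c : K}
    (hrel : ∀ r : ℚ, a * ψ r = (∑ j : Fin (ℓ v₀), ψ ((r + j) / ℓ v₀)) + c * (ℓ v₀ : K)⁻¹ * ψ ((ℓ v₀ : ℚ) * r))
    (h0 : cf v₀ 0 = 1) (h1 : cf v₀ 1 = -(a * (ℓ v₀ : K)⁻¹)) (h2 : cf v₀ 2 = c * ((ℓ v₀ : K)⁻¹) ^ 2) (r : ℚ) :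
    ∑ j : Fin (ℓ v₀), ((∏ v ∈ S, ∑ k ∈ Finset.range 3, MonoidAlgebra.single (ℓ v ^ k) (cf v k) :
        MonoidAlgebra K ℕ).coeff.sum fun m b ↦ b * ψ ((m : ℚ) * ((r + j) / ℓ v₀))) = 0 := by
  classical
  rw [← Finset.mul_prod_erase S _ hv₀]
  simp only [act_mul]
  -- the inner function satisfies the `ℓ_{v₀}`-relation (all other moduli are coprime to `ℓ_{v₀}`)
  obtain ⟨hperS, hrelS⟩ := heckeRel_act_prod_depletionFactor ψ hper hq hrel (S.erase v₀) ℓ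
    (fun v hv ↦ hcop v (Finset.mem_of_mem_erase hv) (Finset.ne_of_mem_erase hv)) cf
  -- the factor at `v₀` is `[1] − a q⁻¹[q] + c q⁻²[q²]`
  have hDv : (∑ k ∈ Finset.range 3, MonoidAlgebra.single (ℓ v₀ ^ k) (cf v₀ k) : MonoidAlgebra K ℕ) =
      MonoidAlgebra.single 1 1 + MonoidAlgebra.single (ℓ v₀) (-(a * (ℓ v₀ : K)⁻¹)) +
        MonoidAlgebra.single (ℓ v₀ ^ 2) (c * ((ℓ v₀ : K)⁻¹) ^ 2) := by
    simp only [Finset.sum_range_succ, Finset.sum_range_zero, zero_add, pow_zero, pow_one, h0, h1, h2]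
  rw [hDv]
  exact heckeU_act_depletionFactor_eq_zero _ hperS hq hqK hrelS r

end Hecke

end Summit.BirchSwinnertonDyer.BirchSwinnertonDyer.Theorems.ThetaLayerLambdaCongruenceAtTwo

end
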